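import Summits.ResolutionOfSingularities.ResolutionOfSingularities.Theses.Descent
import Summits.ResolutionOfSingularities.ResolutionOfSingularities.Theorems.WeightedInvariantDescentPerfectToAllConstantQuotientRegular
import Literature.AlgebraicGeometry.Resolution.LocalUniformization
import Literature.AlgebraicGeometry.Resolution.ResolutionLU

/-!
# Sketch — crux `DescentPerfectToAll` (stmt-ResolutionOfSingularities-0549), crux idea `arc-slice-descent`
# (planner res-B-lens-3 g4, 2026-08-28).  Typed vocabulary only; NOT a registered skeleton; counted 0;
# nothing here proves resolution of singularities in characteristic `p`.

`DiscreteInseparableResidueLU` below is a VERBATIM copy of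
`…Cruxes.DescentPerfectToAll.ValuativeConstantStep.DiscreteInseparableResidueLU` (`Lines/valuative_constant_step.lean`,
commit ba2af02981bf) — that module was unbuilt on the farm at check time, so it is restated here instead of imported.
-/

noncomputable section

set_option linter.dupNamespace false

open Literature.AlgebraicGeometry.Resolution

namespace Summit.ResolutionOfSingularities.ResolutionOfSingularities.Cruxes.DescentPerfectToAll.ArcSlice

/-- VERBATIM COPY of the line's first rung `ValuativeConstantStep.DiscreteInseparableResidueLU` (efd §1.3). -/
def DiscreteInseparableResidueLU (p : ℕ) : Prop :=
  ∀ (k K : Type) [Field k] [CharP k p] [Field K] [Algebra k K], (⊤ : IntermediateField k K).FG →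
    ∀ O : ValuationSubring K, (∀ c : k, algebraMap k K c ∈ O) → IsDiscreteValuationRing O →
      (∀ t : K, t ∈ O → ∃ (c : k) (n : ℕ), O.valuation (t ^ p ^ n - algebraMap k K c) < 1) →
      (∃ t : K, t ∈ O ∧ ∀ c : k, 1 ≤ O.valuation (t - algebraMap k K c)) →
        RelLocalUniformization k K O

/-- THE SUB-RUNG attacked by `arc-slice-descent` (type D, simple exponent-one residue field, separably generated):
relative LU of `K/k` at a DISCRETE rank-one `O ∋ k` when (i) `K/k` has a separating transcendence basis, (ii) the residue
field of `O` is `k(t̄₀)` for ONE `t₀ ∈ O` with `t₀ ^ p ≡ c ∈ k` (every residue is a `k`-polynomial in `t̄₀`), and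
(iii) TYPE D: `c` is a limit of `p`-th powers of `K` (`v(a^p - c)` unbounded), i.e. `γ = c^{1/p}` lies in the completion
`K̂ = k(γ)((x))`.  Extra hypotheses only — a literal special case of `DiscreteInseparableResidueLU` (`sub_rung`). -/
def DiscreteTypeDSimpleResidueLU (p : ℕ) : Prop :=
  ∀ (k K : Type) [Field k] [CharP k p] [Field K] [Algebra k K], (⊤ : IntermediateField k K).FG →
    (∃ (ι : Type) (x : ι → K), IsTranscendenceBasis k x ∧
        Algebra.IsSeparable (IntermediateField.adjoin k (Set.range x)) K) →
    ∀ O : ValuationSubring K, (∀ c : k, algebraMap k K c ∈ O) → IsDiscreteValuationRing O →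
      (∀ t : K, t ∈ O → ∃ (c : k) (n : ℕ), O.valuation (t ^ p ^ n - algebraMap k K c) < 1) →
      (∃ t : K, t ∈ O ∧ ∀ c : k, 1 ≤ O.valuation (t - algebraMap k K c)) →
      (∃ (t₀ : K) (c : k), t₀ ∈ O ∧ O.valuation (t₀ ^ p - algebraMap k K c) < 1 ∧
          (∀ t : K, t ∈ O → ∃ q : Polynomial k, O.valuation (t - Polynomial.aeval t₀ q) < 1) ∧
          (∀ b : K, b ≠ 0 → ∃ a : K, O.valuation (a ^ p - algebraMap k K c) < O.valuation b)) →
        RelLocalUniformization k K O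

/-- The sub-rung IS a special case of the line's first rung (kernel-checked nesting; pure logic). -/
theorem sub_rung {p : ℕ} (h : DiscreteInseparableResidueLU p) : DiscreteTypeDSimpleResidueLU p :=
  fun k K _ _ _ _ hfg _ O h0 hO h1 h2 _ => h k K hfg O h0 hO h1 h2


/-- NEXT RUNG (typed only, no plan assembly yet): the TYPE-E companion of the sub-rung — same data, but instead of type D
the constant `c` has a BEST `p`-th-power approximation of value prime to `p` (`∃ t₁, v(t₁^p - c) ∉ v((Kˣ)^p)`, i.e. `K(c^{1/p})/K`
ramified at `v`).  Paper analysis (NOTES «E-steps»): with the upstairs uniformizer `π = (γ - t₁)^a x^b`, jets in `π`, levels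
`m ≡ 0 (mod p)` and the rescaled derivation `E = π^{J-1}·∂` (`J = p·v_L(γ - t₁)`; the unit `v = (γ - t₁)π^{-J}` lies in `K`),
`E` preserves the truncation models, `E π = a/v` is a slice and `E^p = 0`; so the same engine should decide this rung too. -/
def DiscreteTypeESimpleResidueLU (p : ℕ) : Prop :=
  ∀ (k K : Type) [Field k] [CharP k p] [Field K] [Algebra k K], (⊤ : IntermediateField k K).FG →
    (∃ (ι : Type) (x : ι → K), IsTranscendenceBasis k x ∧
        Algebra.IsSeparable (IntermediateField.adjoin k (Set.range x)) K) →
    ∀ O : ValuationSubring K, (∀ c : k, algebraMap k K c ∈ O) → IsDiscreteValuationRing O →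
      (∀ t : K, t ∈ O → ∃ (c : k) (n : ℕ), O.valuation (t ^ p ^ n - algebraMap k K c) < 1) →
      (∃ t : K, t ∈ O ∧ ∀ c : k, 1 ≤ O.valuation (t - algebraMap k K c)) →
      (∃ (t₀ : K) (c : k), t₀ ∈ O ∧ O.valuation (t₀ ^ p - algebraMap k K c) < 1 ∧
          (∀ t : K, t ∈ O → ∃ q : Polynomial k, O.valuation (t - Polynomial.aeval t₀ q) < 1) ∧
          (∃ t₁ : K, ∀ b : K, O.valuation (t₁ ^ p - algebraMap k K c) ≠ O.valuation (b ^ p))) →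
        RelLocalUniformization k K O

/-- The type-E rung is also a literal special case of the line's first rung. -/
theorem sub_rung_E {p : ℕ} (h : DiscreteInseparableResidueLU p) : DiscreteTypeESimpleResidueLU p :=
  fun k K _ _ _ _ hfg _ O h0 hO h1 h2 _ => h k K hfg O h0 hO h1 h2

/-- STUB R1 `DirectedUnionDiscreteLU` (M, elementary): at a DISCRETE rank-one `O ∋ k`, ONE finitely generated
`A ⊆ O` with `Frac A = K` regular at the centre gives `RelLocalUniformization k K O` (quadratic transforms along `v` stay
regular and dominated; for discrete `v` their union is `O` — induct on `v`(denominator) — so any `R` lands in one). -/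
def DirectedUnionDiscreteLU : Prop :=
  ∀ (k K : Type) [Field k] [Field K] [Algebra k K], (⊤ : IntermediateField k K).FG →
    ∀ O : ValuationSubring K, (∀ c : k, algebraMap k K c ∈ O) → IsDiscreteValuationRing O →
      (∃ (A : Subalgebra k K) (hA : A.toSubring ≤ O.toSubring), A.FG ∧ IsFractionRing A K ∧
        IsRegularLocalRing
          (Localization.AtPrime (Ideal.comap (Subring.inclusion hA) (IsLocalRing.maximalIdeal O)))) →
      RelLocalUniformization k K O

/-- STUB R3 `SliceDescent_p` (M, the glue around the LANDED engine `stub_constantQuotientRegular` / 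
`ConstantQuotientRegular.isRegularLocalRing_of_nilpotent`, p105688): `k ⊆ K ⊆ L`, `d` a `K`-derivation of `L` with
constants exactly `K` and `d^p = 0`; `B ⊆ O_L` an affine `k`-model of `L`, regular at the centre of `O_L`; `s ∈ K ∩ B`
with `s·d(B) ⊆ B` (so `D := s·d ∈ Der(B)`, `D^p = s^p d^p = 0`) and a SLICE `t ∈ B`, `v_L(s·d t) = 0` (unit at the
centre).  Conclusion: the constants `B^d = B ∩ K` contain a finitely generated `A ⊆ O_K`, regular at the centre of
`O_K := O_L ∩ K`, with `Frac A = K`, `A ↦ B` and `B^d ⊆ A`.  [engine: tool E with `a = 0`; bookkeeping: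
`(B_𝔭)^D = (B^d)_{𝔭 ∩ B^d}` via `b/s = b s^{p-1}/s^p`, `B^d` finite over `k[b_i^p]`.] -/
def SliceDescent (p : ℕ) : Prop :=
  ∀ (k K L : Type) [Field k] [CharP k p] [Field K] [Field L] [Algebra k K] [Algebra K L] [Algebra k L]
    [IsScalarTower k K L] (d : Derivation K L L),
    (∀ y : L, d y = 0 → y ∈ Set.range (algebraMap K L)) → (∀ y : L, (⇑d)^[p] y = 0) →
    ∀ (OL : ValuationSubring L) (B : Subalgebra k L) (hB : B.toSubring ≤ OL.toSubring), B.FG → IsFractionRing B L →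
      IsRegularLocalRing
        (Localization.AtPrime (Ideal.comap (Subring.inclusion hB) (IsLocalRing.maximalIdeal OL))) →
      ∀ s : K, algebraMap K L s ∈ B → (∀ b : L, b ∈ B → algebraMap K L s * d b ∈ B) →
      (∃ t : L, t ∈ B ∧ OL.valuation (algebraMap K L s * d t) = 1) →
        ∃ (A : Subalgebra k K) (hA : A.toSubring ≤ (OL.comap (algebraMap K L)).toSubring),
          A.FG ∧ IsFractionRing A K ∧ A.map (IsScalarTower.toAlgHom k K L) ≤ B ∧
          (∀ b : L, b ∈ B → d b = 0 → b ∈ A.map (IsScalarTower.toAlgHom k K L)) ∧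
          IsRegularLocalRing (Localization.AtPrime
            (Ideal.comap (Subring.inclusion hA) (IsLocalRing.maximalIdeal (OL.comap (algebraMap K L)))))

/-- STUB R2 `TruncationSliceModel_p` (L, HARDEST, the NEW content — «arc truncation + slice»): in the sub-rung
situation, upstairs in `L = K(γ)`, `γ^p = c`, `d = ∂/∂γ` (`d γ = 1`, `d^p = 0`, constants `K`), with `O_L ⊇ O` the
(unique) valuation ring — residually RATIONAL over `l₁ = k(γ)` and discrete with a uniformizer `x ∈ K` — SOME arc-truncation
model `B_m = l₁[x, (y - jet_{<m} y)/x^m : y ∈ gens ⊆ K]` is regular at the centre (truncation LU, `m >` the Jacobian order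
along the arc), is stable under `x^m·d` (generators lie in `K`, `d` acts on the `l₁`-coefficients of the jets only) and carries
the slice `t₀^{(m)}` (`x^m d (t₀^{(m)}) = -d(jet t₀) ≡ -dγ = -1`).  Typed as the EXISTENCE of the data `SliceDescent` eats. -/
def TruncationSliceModel (p : ℕ) : Prop :=
  ∀ (k K L : Type) [Field k] [CharP k p] [Field K] [Field L] [Algebra k K] [Algebra K L] [Algebra k L]
    [IsScalarTower k K L], (⊤ : IntermediateField k K).FG →
    (∃ (ι : Type) (x : ι → K), IsTranscendenceBasis k x ∧
        Algebra.IsSeparable (IntermediateField.adjoin k (Set.range x)) K) →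
    ∀ (d : Derivation K L L), (∀ y : L, d y = 0 → y ∈ Set.range (algebraMap K L)) →
      (∀ y : L, (⇑d)^[p] y = 0) →
    ∀ (γ : L) (c : k), γ ^ p = algebraMap k L c → d γ = 1 →
    ∀ OL : ValuationSubring L, (∀ a : k, algebraMap k L a ∈ OL) →
      IsDiscreteValuationRing (OL.comap (algebraMap K L)) →
      (∃ t₀ : K, algebraMap K L t₀ ∈ OL ∧ OL.valuation (algebraMap K L t₀ - γ) < 1 ∧
        ∀ t : K, algebraMap K L t ∈ OL →
          ∃ q : Polynomial k, OL.valuation (algebraMap K L (t - Polynomial.aeval t₀ q)) < 1) →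
      (∀ b : K, b ≠ 0 → ∃ a : K, OL.valuation (algebraMap K L a - γ) < OL.valuation (algebraMap K L b)) →
        ∃ (B : Subalgebra k L) (hB : B.toSubring ≤ OL.toSubring), B.FG ∧ IsFractionRing B L ∧
          IsRegularLocalRing
            (Localization.AtPrime (Ideal.comap (Subring.inclusion hB) (IsLocalRing.maximalIdeal OL))) ∧
          ∃ s : K, algebraMap K L s ∈ B ∧ (∀ b : L, b ∈ B → algebraMap K L s * d b ∈ B) ∧
            ∃ t : L, t ∈ B ∧ OL.valuation (algebraMap K L s * d t) = 1


/-- STUB S0 `RootSetup_p` (M, Mathlib field theory): from the sub-rung data build the constant extension `L = K(γ)`, `γ^p = c`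
(a field: `c ∉ K^p` because `K/k` is separable and `t̄₀ ∉ k`), the `K`-derivation `d = ∂/∂γ` (`d γ = 1`, `d^p = 0`, constants `K`),
the unique valuation ring `O_L` over `O`, and translate the residue / type-D hypotheses to `L` (`(t₀-γ)^p = t₀^p - c`). -/
def RootSetup (p : ℕ) : Prop :=
  ∀ (k K : Type) [Field k] [CharP k p] [Field K] [Algebra k K],
    (∃ (ι : Type) (x : ι → K), IsTranscendenceBasis k x ∧
        Algebra.IsSeparable (IntermediateField.adjoin k (Set.range x)) K) →
    ∀ O : ValuationSubring K, (∀ c : k, algebraMap k K c ∈ O) →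
    (∃ t : K, t ∈ O ∧ ∀ c : k, 1 ≤ O.valuation (t - algebraMap k K c)) →
    ∀ (t₀ : K) (c : k), t₀ ∈ O → O.valuation (t₀ ^ p - algebraMap k K c) < 1 →
      (∀ t : K, t ∈ O → ∃ q : Polynomial k, O.valuation (t - Polynomial.aeval t₀ q) < 1) →
      (∀ b : K, b ≠ 0 → ∃ a : K, O.valuation (a ^ p - algebraMap k K c) < O.valuation b) →
      ∃ (L : Type) (_ : Field L) (_ : Algebra K L) (_ : Algebra k L) (_ : IsScalarTower k K L)
        (d : Derivation K L L) (γ : L) (OL : ValuationSubring L),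
        (∀ y : L, d y = 0 → y ∈ Set.range (algebraMap K L)) ∧ (∀ y : L, (⇑d)^[p] y = 0) ∧
        γ ^ p = algebraMap k L c ∧ d γ = 1 ∧ (∀ a : k, algebraMap k L a ∈ OL) ∧
        OL.comap (algebraMap K L) = O ∧
        OL.valuation (algebraMap K L t₀ - γ) < 1 ∧
        (∀ t : K, algebraMap K L t ∈ OL →
          ∃ q : Polynomial k, OL.valuation (algebraMap K L (t - Polynomial.aeval t₀ q)) < 1) ∧
        (∀ b : K, b ≠ 0 → ∃ a : K, OL.valuation (algebraMap K L a - γ) < OL.valuation (algebraMap K L b))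

/-- ASSEMBLY of the sub-line (kernel-checked, no sorry): the four stub STATEMENTS give the sub-rung. -/
theorem DiscreteTypeDSimpleResidueLU_of {p : ℕ} (h0 : RootSetup p) (h2 : TruncationSliceModel p)
    (h3 : SliceDescent p) (h1 : DirectedUnionDiscreteLU) : DiscreteTypeDSimpleResidueLU p := by
  intro k K _ _ _ _ hfg hsep O hk hO _hres hne hdat
  obtain ⟨t₀, c, ht₀O, ht₀, hpoly, hD⟩ := hdat
  obtain ⟨L, _, _, _, _, d, γ, OL, hdK, hdp, hγ, hdγ, hkL, hcomap, ht₀L, hpolyL, hDL⟩ :=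
    h0 k K hsep O hk hne t₀ c ht₀O ht₀ hpoly hD
  subst hcomap
  obtain ⟨B, hB, hBfg, hBfrac, hBreg, s, hsB, hsd, t, htB, ht⟩ :=
    h2 k K L hfg hsep d hdK hdp γ c hγ hdγ OL hkL hO ⟨t₀, ht₀O, ht₀L, hpolyL⟩ hDL
  obtain ⟨A, hA, hAfg, hAfrac, -, -, hAreg⟩ :=
    h3 k K L d hdK hdp OL B hB hBfg hBfrac hBreg s hsB hsd ⟨t, htB, ht⟩
  exact h1 k K hfg _ hk hO ⟨A, hA, hAfg, hAfrac, hAreg⟩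

/-- ENGINE CHECK (proved, no sorry): the landed tool E specialised to the NILPOTENT case the line uses
(`D^p = 0`, i.e. `p`-closed with `a = 0`), by name. -/
theorem constants_regular_of_nilpotent_slice (p : ℕ) [Fact p.Prime] (R : Type) [CommRing R]
    [IsRegularLocalRing R] [CharP R p] (D : Derivation ℤ R R) (S : Subring R)
    (hS : ∀ x : R, x ∈ S ↔ D x = 0) (hfin : Module.Finite S R) (hnil : ∀ x : R, (⇑D)^[p] x = 0)
    (hslice : ∃ x : R, IsUnit (D x)) : IsRegularLocalRing S :=
  Summit.ResolutionOfSingularities.ResolutionOfSingularities.Theorems.stub_constantQuotientRegular p R D S hS hfin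
    ⟨0, fun x => by rw [hnil x, zero_mul]⟩ hslice

end Summit.ResolutionOfSingularities.ResolutionOfSingularities.Cruxes.DescentPerfectToAll.ArcSlice

end
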